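import Mathlib
import HarnessLib
import HarnessLib.Audit
import Summits.CriticalPhenomena.PercolationContinuityZ3.Theorems.PercNearOneGluingNoHeavyLowerTailHexMS

/-!
# Two thirds of HEX-MS, unconditionally, via Daykin's inequality

Support file for crux `stmt-CriticalPhenomena-4575` (`NoHeavyLowerTail`, route `PercNearOneGluingNoHeavy`), hull-port seat `prim-hp-7`
(generation 65); `--supports stmt-CriticalPhenomena-4575`.  No `sorry`.  Memo: `run/shared/lean/prim/prim-hp-7/FROM-prim-hp-7-g65-REDUCTIONS.md` §0.

Conjecture HEX-MS (`GeneratedDonors.HexMS`, g64) asks for `#𝒟 ≤ 2 · #(gen 𝒟 x)` for every complement-closed family `𝒟` with an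
antipodal `ZMod 6`-labelling `x` (`gen` = differences `a \ b` of members with CLOSE labels).  Here we prove the weaker constant THREE:

* `card_le_three_mul_card_gen` — `#𝒟 ≤ 3 · #(gen 𝒟 x)` for every such `(𝒟, x)`.

Proof.  Key remark: `a \ b = a ∩ (univ \ b)` and `x (univ \ b) = x b + 3`, so `gen` is also the family of INTERSECTIONS `a ∩ c` of members
with FAR labels (cyclic distance ≥ 2), and its complement-image is the family of far UNIONS.  Split `𝒟` by labels into the three 'adjacent
pairs' `sᵢ = {a ∈ 𝒟 : x a ∈ {i, i+1}}`, `i = 0, 2, 4`; the opposite pair `tᵢ = {x ∈ {i+3, i+4}}` has `#tᵢ = #sᵢ` (complementation) and every label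
of `sᵢ` is far from every label of `tᵢ`, so `sᵢ ⊼ tᵢ ⊆ gen` and `sᵢ ⊻ tᵢ ⊆ co gen`.  Daykin's inequality (a corollary of the
Ahlswede–Daykin four functions theorem, Mathlib `Finset.le_card_infs_mul_card_sups`) gives `#sᵢ · #tᵢ ≤ #(sᵢ ⊼ tᵢ) · #(sᵢ ⊻ tᵢ) ≤ #gen²`,
hence `#sᵢ ≤ #gen`, and summing over the three pairs `#𝒟 ≤ 3 · #gen`.  (With labels on at most two adjacent axes one of the three
pairs is empty and the same argument returns the factor 2 of `hexMSAt_of_adjacent`; the genuinely three-axis case is where HEX-MS is open —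
exact SAT certificates n ≤ 6, memo §0.)
-/

namespace Summit.CriticalPhenomena.PercolationContinuityZ3.Theorems

namespace GeneratedDonors

open Finset FinsetFamily

section Labels

/-- Label bookkeeping in `ZMod 6`: a label of the pair `{i, i+1}` shifted by `3` lies in the pair `{i+3, i+4}`. -/
theorem add_three_mem_oppPair {i s : ZMod 6} (hs : s = i ∨ s = i + 1) : s + 3 = i + 3 ∨ s + 3 = i + 4 := by
  revert i s; decide

/-- Label bookkeeping in `ZMod 6`: a label of the pair `{i+3, i+4}` shifted by `3` lies in the pair `{i, i+1}`. -/
theorem add_three_mem_pair {i t : ZMod 6} (ht : t = i + 3 ∨ t = i + 4) : t + 3 = i ∨ t + 3 = i + 1 := by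
  revert i t; decide

/-- Label bookkeeping in `ZMod 6`: the pair `{i+3, i+4}` is the adjacent pair based at `i + 3`. -/
theorem mem_pair_base_add_three {i t : ZMod 6} (ht : t = i + 3 ∨ t = i + 4) : t = i + 3 ∨ t = i + 3 + 1 := by
  revert i t; decide

/-- Label bookkeeping in `ZMod 6`: every label lies in one of the three adjacent pairs based at `j`, `j + 2`, `j + 4`. -/
theorem mem_three_pairs (j v : ZMod 6) :
    (v = j ∨ v = j + 1) ∨ (v = j + 2 ∨ v = j + 2 + 1) ∨ (v = j + 4 ∨ v = j + 4 + 1) := by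
  revert j v; decide

end Labels


section Daykin

variable {α : Type*} [Fintype α] [DecidableEq α]

/-- FAR INTERSECTIONS ARE GENERATED: for `a` with label in `{i, i+1}` and `c` with label in `{i+3, i+4}`,
`a ∩ c = a \ (univ \ c)` with `x (univ \ c) = x c + 3` close to `x a`. -/
theorem infs_labPair_subset_gen {𝒟 : Finset (Finset α)} {x : Finset α → ZMod 6}
    (hcompl : ∀ a ∈ 𝒟, univ \ a ∈ 𝒟) (hanti : ∀ a ∈ 𝒟, x (univ \ a) = x a + 3) (i : ZMod 6) :
    (𝒟.filter fun a => x a = i ∨ x a = i + 1) ⊼ (𝒟.filter fun a => x a = i + 3 ∨ x a = i + 3 + 1) ⊆ gen 𝒟 x := by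
  intro d hd
  rw [mem_infs] at hd
  obtain ⟨a, ha, c, hc, rfl⟩ := hd
  rw [mem_filter] at ha hc
  have hc2 : x c = i + 3 ∨ x c = i + 4 := by
    rcases hc.2 with h | h
    · exact Or.inl h
    · exact Or.inr (by rw [h]; ring)
  refine mem_gen.mpr ⟨a, ha.1, univ \ c, hcompl c hc.1, ?_, ?_⟩
  · rw [hanti c hc.1]
    exact close_of_mem_pair ha.2 (add_three_mem_pair hc2)
  · ext e
    simp only [mem_sdiff, mem_univ, true_and, not_not, inf_eq_inter, mem_inter]

/-- FAR UNIONS ARE COMPLEMENTS OF GENERATED SETS: `a ∪ c = univ \ ((univ \ a) \ c)` with `x (univ \ a) = x a + 3` close to `x c`. -/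
theorem sups_labPair_subset_image_gen {𝒟 : Finset (Finset α)} {x : Finset α → ZMod 6}
    (hcompl : ∀ a ∈ 𝒟, univ \ a ∈ 𝒟) (hanti : ∀ a ∈ 𝒟, x (univ \ a) = x a + 3) (i : ZMod 6) :
    (𝒟.filter fun a => x a = i ∨ x a = i + 1) ⊻ (𝒟.filter fun a => x a = i + 3 ∨ x a = i + 3 + 1) ⊆ (gen 𝒟 x).image fun d => univ \ d := by
  intro d hd
  rw [mem_sups] at hd
  obtain ⟨a, ha, c, hc, rfl⟩ := hd
  rw [mem_filter] at ha hc
  refine mem_image.mpr ⟨(univ \ a) \ c, mem_gen.mpr ⟨univ \ a, hcompl a ha.1, c, hc.1, ?_, rfl⟩, ?_⟩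
  · rw [hanti a ha.1]
    exact close_of_mem_pair (mem_pair_base_add_three (add_three_mem_oppPair ha.2)) hc.2
  · ext e
    simp only [mem_sdiff, mem_univ, true_and, sup_eq_union, mem_union]
    tauto

/-- Complementation is a bijection between the opposite label pairs, so they have the same size. -/
theorem card_labPair_add_three {𝒟 : Finset (Finset α)} {x : Finset α → ZMod 6}
    (hcompl : ∀ a ∈ 𝒟, univ \ a ∈ 𝒟) (hanti : ∀ a ∈ 𝒟, x (univ \ a) = x a + 3) (i : ZMod 6) :
    #((𝒟.filter fun a => x a = i + 3 ∨ x a = i + 3 + 1)) = #((𝒟.filter fun a => x a = i ∨ x a = i + 1)) := by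
  have hcc : ∀ a : Finset α, univ \ (univ \ a) = a := fun a => by
    rw [Finset.sdiff_sdiff_eq_self (subset_univ a)]
  refine card_bij' (fun a _ => univ \ a) (fun a _ => univ \ a) (fun a ha => ?_) (fun a ha => ?_)
    (fun a _ => hcc a) (fun a _ => hcc a)
  · rw [mem_filter] at ha ⊢
    have h2 : x a = i + 3 ∨ x a = i + 4 := by
      rcases ha.2 with h | h
      · exact Or.inl h
      · exact Or.inr (by rw [h]; ring)
    refine ⟨hcompl a ha.1, ?_⟩
    rw [hanti a ha.1]
    exact add_three_mem_pair h2
  · rw [mem_filter] at ha ⊢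
    refine ⟨hcompl a ha.1, ?_⟩
    rw [hanti a ha.1]
    exact mem_pair_base_add_three (add_three_mem_oppPair ha.2)

/-- DAYKIN STEP: each adjacent label pair has at most `#(gen 𝒟 x)` members, since
`#sᵢ² = #sᵢ · #tᵢ ≤ #(sᵢ ⊼ tᵢ) · #(sᵢ ⊻ tᵢ) ≤ #(gen 𝒟 x)²`. -/
theorem card_labPair_le_card_gen {𝒟 : Finset (Finset α)} {x : Finset α → ZMod 6}
    (hcompl : ∀ a ∈ 𝒟, univ \ a ∈ 𝒟) (hanti : ∀ a ∈ 𝒟, x (univ \ a) = x a + 3) (i : ZMod 6) :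
    #((𝒟.filter fun a => x a = i ∨ x a = i + 1)) ≤ #(gen 𝒟 x) := by
  have hD := Finset.le_card_infs_mul_card_sups ((𝒟.filter fun a => x a = i ∨ x a = i + 1)) ((𝒟.filter fun a => x a = i + 3 ∨ x a = i + 3 + 1))
  have h1 : #((𝒟.filter fun a => x a = i ∨ x a = i + 1) ⊼ (𝒟.filter fun a => x a = i + 3 ∨ x a = i + 3 + 1)) ≤ #(gen 𝒟 x) :=
    card_le_card (infs_labPair_subset_gen hcompl hanti i)
  have h2 : #((𝒟.filter fun a => x a = i ∨ x a = i + 1) ⊻ (𝒟.filter fun a => x a = i + 3 ∨ x a = i + 3 + 1)) ≤ #(gen 𝒟 x) :=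
    (card_le_card (sups_labPair_subset_image_gen hcompl hanti i)).trans card_image_le
  rw [card_labPair_add_three hcompl hanti i] at hD
  have hsq : #((𝒟.filter fun a => x a = i ∨ x a = i + 1)) * #((𝒟.filter fun a => x a = i ∨ x a = i + 1)) ≤ #(gen 𝒟 x) * #(gen 𝒟 x) :=
    hD.trans (Nat.mul_le_mul h1 h2)
  exact not_lt.mp fun h => absurd hsq (not_le.mpr (Nat.mul_self_lt_mul_self h))

/-- ★ **TWO THIRDS OF HEX-MS** (hp-7 g65, via Ahlswede–Daykin): for every complement-closed family with an antipodal `ZMod 6`-labelling,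
`#𝒟 ≤ 3 · #(gen 𝒟 x)` — the generated differences number at least a THIRD of `𝒟` (HEX-MS conjectures a half).  Unconditional. -/
theorem card_le_three_mul_card_gen (𝒟 : Finset (Finset α)) (x : Finset α → ZMod 6)
    (hcompl : ∀ a ∈ 𝒟, univ \ a ∈ 𝒟) (hanti : ∀ a ∈ 𝒟, x (univ \ a) = x a + 3) :
    #𝒟 ≤ 3 * #(gen 𝒟 x) := by
  have h0 := card_labPair_le_card_gen hcompl hanti 0
  have h2 := card_labPair_le_card_gen hcompl hanti (0 + 2)
  have h4 := card_labPair_le_card_gen hcompl hanti (0 + 4)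
  have hcover : 𝒟 ⊆ (𝒟.filter fun a => x a = 0 ∨ x a = 0 + 1) ∪ ((𝒟.filter fun a => x a = 0 + 2 ∨ x a = 0 + 2 + 1) ∪ (𝒟.filter fun a => x a = 0 + 4 ∨ x a = 0 + 4 + 1)) := by
    intro a ha
    rw [mem_union, mem_union, mem_filter, mem_filter, mem_filter]
    rcases mem_three_pairs 0 (x a) with h | h | h
    · exact Or.inl ⟨ha, h⟩
    · exact Or.inr (Or.inl ⟨ha, h⟩)
    · exact Or.inr (Or.inr ⟨ha, h⟩)
  have hc1 := card_le_card hcover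
  have hc2 := card_union_le ((𝒟.filter fun a => x a = 0 ∨ x a = 0 + 1)) ((𝒟.filter fun a => x a = 0 + 2 ∨ x a = 0 + 2 + 1) ∪ (𝒟.filter fun a => x a = 0 + 4 ∨ x a = 0 + 4 + 1))
  have hc3 := card_union_le ((𝒟.filter fun a => x a = 0 + 2 ∨ x a = 0 + 2 + 1)) ((𝒟.filter fun a => x a = 0 + 4 ∨ x a = 0 + 4 + 1))
  omega

/-- The same bound phrased for ONE adjacent pair: twice any label pair `{i, i+1}` plus its opposite is at most `2 · #gen`; in
particular if some adjacent pair `{j, j+1}` carries no member (labels on at most two adjacent axes) the factor-2 statement `HexMSAt`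
follows — a second proof of `hexMSAt_of_adjacent`, recorded as a consistency check of the method. -/
theorem hexMSAt_of_labPair_empty (𝒟 : Finset (Finset α)) (x : Finset α → ZMod 6) (j : ZMod 6)
    (hj : (𝒟.filter fun a => x a = j ∨ x a = j + 1) = ∅) : HexMSAt 𝒟 x := by
  intro hcompl hanti
  have ha := card_labPair_le_card_gen hcompl hanti (j + 2)
  have hb := card_labPair_le_card_gen hcompl hanti (j + 4)
  have hcover : 𝒟 ⊆ (𝒟.filter fun a => x a = j + 2 ∨ x a = j + 2 + 1) ∪ (𝒟.filter fun a => x a = j + 4 ∨ x a = j + 4 + 1) := by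
    intro a haD
    rw [mem_union, mem_filter, mem_filter]
    rcases mem_three_pairs j (x a) with h | h | h
    · have : a ∈ (𝒟.filter fun a => x a = j ∨ x a = j + 1) := mem_filter.mpr ⟨haD, h⟩
      rw [hj] at this
      exact absurd this (Finset.notMem_empty a)
    · exact Or.inl ⟨haD, h⟩
    · exact Or.inr ⟨haD, h⟩
  have hc1 := card_le_card hcover
  have hc2 := card_union_le ((𝒟.filter fun a => x a = j + 2 ∨ x a = j + 2 + 1)) ((𝒟.filter fun a => x a = j + 4 ∨ x a = j + 4 + 1))
  omega

end Daykin

end GeneratedDonors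

end Summit.CriticalPhenomena.PercolationContinuityZ3.Theorems
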